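import Literature.Geometry.Symplectic.FoldFormsFourFoldsGlueProofs
import Literature.Topology.FourManifolds.BoundaryGluingConstruction
import Literature.Topology.FourManifolds.GluingConstructionMaps
import HarnessLib

/-!
# Fold-forms for four-folds — assembling the folded form on the glued manifold

Continuation of `FoldFormsFourFoldsGlueProofs.lean` (Baykur's gluing argument for
Cannas da Silva's Theorem 2, [cite: Baykur2006, Thm. 6.1], [cite: Cannasdasilva2010, Thm. 2]):
local inverses of the structure embeddings of a boundary gluing `P = W₁ ∪ (H × ℝ) ∪ W₂`
(`BoundaryGluingConstruction.lean`), push-forward of forms along them, and the assembly of the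
glued `2`-form with folds exactly along the seam `H × {0}`.

## Main statements

* Section `LocalInverse` — `contMDiffAt_invFun_of_leftInverse`: an injective open smooth map with
  a local smooth left inverse has a smooth (global, `Function.invFun`) inverse near each image
  point; the structure maps `inl`, `inr` of a `SmoothGlueData` and their composites qualify;
  push-forward of forms along such maps (`smoothAt_pullback_invFun`, `mextDeriv_pullback_invFun`,
  `pullback_pullback_invFun_apply`, `not_mem_fold_pullback_invFun`).
* Section `GlueMaps` — the three structure embeddings of a boundary gluing `G : BoundaryGlueData`:
  the seam piece `seamEmb G = inl ∘ inl`, the interiors `intEmbM G = inl ∘ inr`, `intEmbN G = inr`;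
  injective, open, smooth, with smooth inverses; the gluing relations `seamEmb_eq_intEmbM`
  (`s > 0`), `seamEmb_eq_intEmbN` (`s < 0`); the cover `exists_seamEmb_or`; the lifted chart
  `seamChartP G p` at a seam point and its formula `seamChartP_seamEmb`.
* Sections `SeamFlat`, `SeamZone` — `mextDeriv_eq_pullback_of_flatRep` (a seam primitive reading
  flat as `Φ̂ b̂` has `dΛ = κ^* d(Φ̂ b̂)`), `pullback_invFun_seamEmb_eventuallyEq` (near a seam
  point the push-forward of `dΛ` is the pull-back of the flat model along the lifted chart) and
  `def_one_germ_seamEmb` (the clause of `def_one_of_locally` at a seam point, from the flat fold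
  or symplectic data).
* Section `InteriorZone` — `def_one_germ_pushforward`: the clause of `def_one_of_locally` at an
  image point of a push-forward of a smooth closed non-degenerate form (no fold there).
* Section `GluedForm` — `gluedForm G δ Λ τM τN` (push-forward of `dΛ` on the seam zone
  `σ (H × (-3δ, 3δ))`, of `τM`, `τN` on the interiors off it), its regional germs
  (`gluedForm_eventuallyEq_seamEmb/intEmbM/intEmbN`, the latter two under the compatibility of
  the push-forwards on the overlaps `(2δ, 3δ)`, `(-3δ, -2δ)`), the cover `mem_seamZone_or`, and
  **`def_one_gluedForm`**: the glued form is smooth, closed and satisfies the transversality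
  and maximal-rank clauses of Def. 1 [cite: Cannasdasilva2010, Def. 1] along its fold.
-/

noncomputable section

open scoped Manifold ContDiff Topology
open Set Function Filter
open Literature.Geometry.Kaehler Literature.Topology.FourManifolds

namespace Literature.Geometry.Symplectic

/-! ### Local inverses of injective open smooth maps -/

section LocalInverse

variable {EA HA : Type*} [NormedAddCommGroup EA] [NormedSpace ℝ EA] [TopologicalSpace HA]
  {IA : ModelWithCorners ℝ EA HA}
  {EB HB : Type*} [NormedAddCommGroup EB] [NormedSpace ℝ EB] [TopologicalSpace HB]
  {IB : ModelWithCorners ℝ EB HB}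
  {EP HP : Type*} [NormedAddCommGroup EP] [NormedSpace ℝ EP] [TopologicalSpace HP]
  {IP : ModelWithCorners ℝ EP HP}
  {A : Type*} [TopologicalSpace A] [ChartedSpace HA A]
  {B : Type*} [TopologicalSpace B] [ChartedSpace HB B]
  {P : Type*} [TopologicalSpace P] [ChartedSpace HP P]

/-- **An injective open map with a local smooth left inverse has a smooth inverse**: its
(global) `Function.invFun` is smooth at every image point. [folklore] -/
theorem contMDiffAt_invFun_of_leftInverse [Nonempty A] {f : A → P} (hinj : Injective f)
    (hopen : IsOpenMap f) {a : A} {g : P → A} (hg : ContMDiffAt IP IA ∞ g (f a))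
    (hgf : ∀ᶠ a' in 𝓝 a, g (f a') = a') :
    ContMDiffAt IP IA ∞ (Function.invFun f) (f a) := by
  obtain ⟨V, hV, hVo, haV⟩ := eventually_nhds_iff.1 hgf
  have hev : Function.invFun f =ᶠ[𝓝 (f a)] g := by
    filter_upwards [(hopen V hVo).mem_nhds (mem_image_of_mem f haV)] with q hq
    obtain ⟨a', ha', rfl⟩ := hq
    rw [Function.leftInverse_invFun hinj a', hV a' ha']
  exact hg.congr_of_eventuallyEq hev

/-- The inverse of a composite of two injective open maps with smooth inverses is smooth at the
image points. [folklore] -/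
theorem contMDiffAt_invFun_comp [Nonempty A] [Nonempty B] {f₁ : A → B} {f₂ : B → P}
    (h₁inj : Injective f₁) (h₁open : IsOpenMap f₁) (h₂inj : Injective f₂) (h₂open : IsOpenMap f₂)
    {a : A} (h₁ : ContMDiffAt IB IA ∞ (Function.invFun f₁) (f₁ a))
    (h₂ : ContMDiffAt IP IB ∞ (Function.invFun f₂) (f₂ (f₁ a))) :
    ContMDiffAt IP IA ∞ (Function.invFun (f₂ ∘ f₁)) ((f₂ ∘ f₁) a) := by
  have h₁' : ContMDiffAt IB IA ∞ (Function.invFun f₁) (Function.invFun f₂ (f₂ (f₁ a))) := by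
    rw [Function.leftInverse_invFun h₂inj (f₁ a)]; exact h₁
  refine contMDiffAt_invFun_of_leftInverse (h₂inj.comp h₁inj) (h₂open.comp h₁open)
    (g := Function.invFun f₁ ∘ Function.invFun f₂) (h₁'.comp _ h₂) (Eventually.of_forall fun a' => ?_)
  show Function.invFun f₁ (Function.invFun f₂ (f₂ (f₁ a'))) = a'
  rw [Function.leftInverse_invFun h₂inj (f₁ a'), Function.leftInverse_invFun h₁inj a']

variable [Nonempty A] {f : A → P}

/-- Near an image point, the inverse is smooth at every point (the range is open). [folklore] -/
theorem eventually_contMDiffAt_invFun (hopen : IsOpenMap f)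
    (hinv : ∀ a, ContMDiffAt IP IA ∞ (Function.invFun f) (f a)) (a : A) :
    ∀ᶠ q in 𝓝 (f a), ContMDiffAt IP IA ∞ (Function.invFun f) q := by
  filter_upwards [hopen.isOpen_range.mem_nhds (mem_range_self a)] with q hq
  obtain ⟨a', rfl⟩ := hq
  exact hinv a'

/-- `f ∘ f⁻¹ = id` near an image point. [folklore] -/
theorem comp_invFun_eventuallyEq_id (hinj : Injective f) (hopen : IsOpenMap f) (a : A) :
    (f ∘ Function.invFun f) =ᶠ[𝓝 (f a)] id := by
  filter_upwards [hopen.isOpen_range.mem_nhds (mem_range_self a)] with q hq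
  obtain ⟨a', rfl⟩ := hq
  show f (Function.invFun f (f a')) = f a'
  rw [Function.leftInverse_invFun hinj a']

variable {F : Type*} [NormedAddCommGroup F] [NormedSpace ℝ F] {k : ℕ}

omit [Nonempty A] in
/-- Evaluating a form at propositionally equal points (any coefficients). [folklore] -/
theorem MForm.apply_congr_point' (α : MForm IA A F k) {y y' : A} (e : y = y')
    (w : Fin k → EA) : α y w = α y' w := by
  subst e
  rfl

/-- `D(f⁻¹)_{f a} ∘ Df_a = id`. [folklore] -/
theorem mfderiv_invFun_comp_mfderiv (hinj : Injective f) (hf : ContMDiff IA IP ∞ f)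
    (hinv : ∀ a, ContMDiffAt IP IA ∞ (Function.invFun f) (f a)) (a : A) :
    (mfderiv IP IA (Function.invFun f) (f a)).comp (mfderiv IA IP f a) =
      ContinuousLinearMap.id ℝ (TangentSpace IA a) := by
  have h1 : mfderiv IA IA (Function.invFun f ∘ f) a =
      (mfderiv IP IA (Function.invFun f) (f a)).comp (mfderiv IA IP f a) :=
    mfderiv_comp a ((hinv a).mdifferentiableAt (by simp)) ((hf a).mdifferentiableAt (by simp))
  have h2 : (Function.invFun f ∘ f) = id := funext fun a' => Function.leftInverse_invFun hinj a'
  rw [← h1, h2, mfderiv_id]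

/-- `Df_a ∘ D(f⁻¹)_{f a} = id`. [folklore] -/
theorem mfderiv_comp_mfderiv_invFun (hinj : Injective f) (hopen : IsOpenMap f)
    (hf : ContMDiff IA IP ∞ f) (hinv : ∀ a, ContMDiffAt IP IA ∞ (Function.invFun f) (f a)) (a : A) :
    (mfderiv IA IP f a).comp (mfderiv IP IA (Function.invFun f) (f a)) =
      ContinuousLinearMap.id ℝ (TangentSpace IP (f a)) := by
  have hfa : MDifferentiableAt IA IP f (Function.invFun f (f a)) := by
    rw [Function.leftInverse_invFun hinj a]; exact (hf a).mdifferentiableAt (by simp)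
  have h1 : mfderiv IP IP (f ∘ Function.invFun f) (f a) =
      (mfderiv IA IP f (Function.invFun f (f a))).comp (mfderiv IP IA (Function.invFun f) (f a)) :=
    mfderiv_comp (f a) hfa ((hinv a).mdifferentiableAt (by simp))
  rw [Function.leftInverse_invFun hinj a] at h1
  rw [← h1, (comp_invFun_eventuallyEq_id hinj hopen a).mfderiv_eq, mfderiv_id]

/-- The differential of the inverse at an image point is injective. [folklore] -/
theorem injective_mfderiv_invFun (hinj : Injective f) (hopen : IsOpenMap f)
    (hf : ContMDiff IA IP ∞ f) (hinv : ∀ a, ContMDiffAt IP IA ∞ (Function.invFun f) (f a)) (a : A) :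
    Injective (mfderiv IP IA (Function.invFun f) (f a)) := by
  intro v w hvw
  have h := congrArg (mfderiv IA IP f a) hvw
  have hid := mfderiv_comp_mfderiv_invFun hinj hopen hf hinv a
  have hv := congrArg (fun T : TangentSpace IP (f a) →L[ℝ] TangentSpace IP (f a) => T v) hid
  have hw := congrArg (fun T : TangentSpace IP (f a) →L[ℝ] TangentSpace IP (f a) => T w) hid
  have h' : ((mfderiv IA IP f a).comp (mfderiv IP IA (Function.invFun f) (f a))) v =
      ((mfderiv IA IP f a).comp (mfderiv IP IA (Function.invFun f) (f a))) w := h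
  exact (hv.symm.trans (h'.trans hw))

/-- The differential of `f` at `a` is injective. [folklore] -/
theorem injective_mfderiv_of_invFun (hinj : Injective f) (hf : ContMDiff IA IP ∞ f)
    (hinv : ∀ a, ContMDiffAt IP IA ∞ (Function.invFun f) (f a)) (a : A) :
    Injective (mfderiv IA IP f a) := by
  intro v w hvw
  have h := congrArg (mfderiv IP IA (Function.invFun f) (f a)) hvw
  have hid := mfderiv_invFun_comp_mfderiv hinj hf hinv a
  have hv := congrArg (fun T : TangentSpace IA a →L[ℝ] TangentSpace IA a => T v) hid
  have hw := congrArg (fun T : TangentSpace IA a →L[ℝ] TangentSpace IA a => T w) hid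
  have h' : ((mfderiv IP IA (Function.invFun f) (f a)).comp (mfderiv IA IP f a)) v =
      ((mfderiv IP IA (Function.invFun f) (f a)).comp (mfderiv IA IP f a)) w := h
  exact (hv.symm.trans (h'.trans hw))

/-- **Pulling a push-forward back recovers the form**: `f^*((f⁻¹)^*τ) = τ`, pointwise. [folklore] -/
theorem pullback_pullback_invFun_apply (hinj : Injective f) (hf : ContMDiff IA IP ∞ f)
    (hinv : ∀ a, ContMDiffAt IP IA ∞ (Function.invFun f) (f a)) (τ : MForm IA A F k) (a : A) :
    ((τ.pullback IP (Function.invFun f)).pullback IA f) a = τ a := by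
  have hid := mfderiv_invFun_comp_mfderiv hinj hf hinv a
  ext V
  rw [MForm.pullback_apply, MForm.pullback_apply,
    MForm.apply_congr_point' τ (Function.leftInverse_invFun hinj a)]
  congr 1
  funext i
  exact congrArg (fun T : TangentSpace IA a →L[ℝ] TangentSpace IA a => T (V i)) hid

variable [IsManifold IA ∞ A] [IsManifold IP ∞ P]

/-- **Push-forward of a form along an injective open smooth map with smooth inverse is smooth**
at the image points where the form is. [folklore] -/
theorem smoothAt_pullback_invFun (hinj : Injective f) (hopen : IsOpenMap f)
    (hinv : ∀ a, ContMDiffAt IP IA ∞ (Function.invFun f) (f a)) {τ : MForm IA A F k} {a : A}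
    (hτ : τ.SmoothAt a) : (τ.pullback IP (Function.invFun f)).SmoothAt (f a) := by
  refine MForm.SmoothAt.pullback (eventually_contMDiffAt_invFun hopen hinv a) ?_
  rw [Function.leftInverse_invFun hinj a]; exact hτ

/-- The exterior derivative of a push-forward is the push-forward of the exterior derivative,
at image points where the form is smooth. [folklore] -/
theorem mextDeriv_pullback_invFun (hinj : Injective f) (hopen : IsOpenMap f)
    (hinv : ∀ a, ContMDiffAt IP IA ∞ (Function.invFun f) (f a)) {τ : MForm IA A F k} {a : A}
    (hτ : τ.SmoothAt a) :
    mextDeriv (τ.pullback IP (Function.invFun f)) (f a) =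
      (mextDeriv τ).pullback IP (Function.invFun f) (f a) := by
  refine mextDeriv_pullback_apply (eventually_contMDiffAt_invFun hopen hinv a) ?_
  rw [Function.leftInverse_invFun hinj a]; exact hτ

end LocalInverse

/-! ### Push-forward and the fold, for `4`-manifolds -/

section LocalInverseFour

variable {A : Type*} [TopologicalSpace A] [ChartedSpace (EuclideanSpace ℝ (Fin 4)) A]
  {P : Type*} [TopologicalSpace P] [ChartedSpace (EuclideanSpace ℝ (Fin 4)) P]
  [Nonempty A] {f : A → P}

/-- **Off the fold of `τ`, the push-forward `(f⁻¹)^*τ` has no fold** (at image points).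
[folklore] -/
theorem not_mem_fold_pullback_invFun [IsManifold (𝓡 4) ∞ A] [IsManifold (𝓡 4) ∞ P]
    (hinj : Injective f) (hopen : IsOpenMap f) (hf : ContMDiff (𝓡 4) (𝓡 4) ∞ f)
    (hinv : ∀ a, ContMDiffAt (𝓡 4) (𝓡 4) ∞ (Function.invFun f) (f a)) {τ : MForm (𝓡 4) A ℝ 2}
    {a : A} (ha : a ∉ fold τ) : f a ∉ fold (τ.pullback (𝓡 4) (Function.invFun f)) := by
  refine not_mem_fold_pullback τ (Function.invFun f) ?_ fun v hv h0 => hv ?_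
  · rw [Function.leftInverse_invFun hinj a]; exact ha
  · exact injective_mfderiv_invFun hinj hopen hf hinv a (h0.trans (map_zero _).symm)

end LocalInverseFour


/-! ### The structure embeddings of a glued space have smooth inverses -/

section GlueDataInverse

variable {E_A H_A E_B H_B : Type*}
  [NormedAddCommGroup E_A] [NormedSpace ℝ E_A] [TopologicalSpace H_A]
  [NormedAddCommGroup E_B] [NormedSpace ℝ E_B] [TopologicalSpace H_B]
  {I_A : ModelWithCorners ℝ E_A H_A} {I_B : ModelWithCorners ℝ E_B H_B}
  {A : Type*} [TopologicalSpace A] [ChartedSpace H_A A]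
  {B : Type*} [TopologicalSpace B] [ChartedSpace H_B B]
  {E_P : Type*} [NormedAddCommGroup E_P] [NormedSpace ℝ E_P]
  (d : SmoothGlueData I_A I_B A B E_P)
  [I_A.Boundaryless] [I_B.Boundaryless] [IsManifold I_A ∞ A] [IsManifold I_B ∞ B]

/-- The inverse of `inl : A → A ∪_ψ B` is smooth at the image points. [folklore] -/
theorem SmoothGlueData.contMDiffAt_invFun_inl [Nonempty A] (a : A) :
    ContMDiffAt 𝓘(ℝ, E_P) I_A ∞ (Function.invFun d.inl) (d.inl a) := by
  refine contMDiffAt_invFun_of_leftInverse d.inl_injective d.isOpenMap_inl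
    (d.contMDiffAt_retrA_chartAt a) ?_
  filter_upwards [(chartAt H_A a).open_source.mem_nhds (mem_chart_source H_A a)] with a' ha'
  exact SmoothGlueData.retrA_inl ha'

/-- The inverse of `inr : B → A ∪_ψ B` is smooth at the image points. [folklore] -/
theorem SmoothGlueData.contMDiffAt_invFun_inr [Nonempty B] (b : B) :
    ContMDiffAt 𝓘(ℝ, E_P) I_B ∞ (Function.invFun d.inr) (d.inr b) := by
  refine contMDiffAt_invFun_of_leftInverse d.inr_injective d.isOpenMap_inr
    (d.contMDiffAt_retrB_chartAt b) ?_
  filter_upwards [(chartAt H_B b).open_source.mem_nhds (mem_chart_source H_B b)] with b' hb'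
  exact SmoothGlueData.retrB_inr hb'

end GlueDataInverse

/-! ### The three structure embeddings of a boundary gluing

`P = G.d₂.Glued` is covered by the seam piece `σ (x, s) = inl (inl (x, s))`, the interior of the
first piece `ι₁ a = inl (inr a)` and the interior of the second piece `ι₂ c = inr c`; all three
are injective open smooth maps with smooth inverses, `σ (x, s) = ι₁ (CM x s)` for `s > 0` and
`σ (x, s) = ι₂ (CN (φ x) (-s))` for `s < 0`. -/

section GlueMaps

universe u

variable {n : ℕ} {M N : Type u} [TopologicalSpace M] [ChartedSpace (EuclideanHalfSpace (n + 1)) M]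
  [TopologicalSpace N] [ChartedSpace (EuclideanHalfSpace (n + 1)) N]
  [IsManifold (𝓡∂ (n + 1)) ∞ M] [IsManifold (𝓡∂ (n + 1)) ∞ N]
  {bM : BoundaryData (𝓡∂ (n + 1)) M (𝓡 n)} {bN : BoundaryData (𝓡∂ (n + 1)) N (𝓡 n)}
  (G : BoundaryGlueData bM bN) [Nonempty bM.carrier]

/-- The seam piece `σ : ∂M × ℝ → P`, `σ = inl ∘ inl`. [folklore] -/
def seamEmb (p : bM.carrier × ℝ) : G.d₂.Glued := G.d₂.inl (G.d₁.inl p)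

/-- The interior of the first piece, `ι₁ = inl ∘ inr : M - ∂M → P`. [folklore] -/
def intEmbM (a : InteriorManifold (𝓡∂ (n + 1)) M) : G.d₂.Glued := G.d₂.inl (G.d₁.inr a)

/-- The interior of the second piece, `ι₂ = inr : N - ∂N → P`. [folklore] -/
def intEmbN (c : InteriorManifold (𝓡∂ (n + 1)) N) : G.d₂.Glued := G.d₂.inr c

/-- Unfolding `seamEmb`. [folklore] -/
theorem seamEmb_apply (p : bM.carrier × ℝ) : seamEmb G p = G.d₂.inl (G.d₁.inl p) := rfl

/-- Unfolding `intEmbM`. [folklore] -/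
theorem intEmbM_apply (a : InteriorManifold (𝓡∂ (n + 1)) M) : intEmbM G a = G.d₂.inl (G.d₁.inr a) :=
  rfl

/-- Unfolding `intEmbN`. [folklore] -/
theorem intEmbN_apply (c : InteriorManifold (𝓡∂ (n + 1)) N) : intEmbN G c = G.d₂.inr c := rfl

/-- `σ` is injective. [folklore] -/
theorem injective_seamEmb : Injective (seamEmb G) :=
  G.d₂.inl_injective.comp G.d₁.inl_injective

/-- `ι₁` is injective. [folklore] -/
theorem injective_intEmbM : Injective (intEmbM G) :=
  G.d₂.inl_injective.comp G.d₁.inr_injective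

/-- `ι₂` is injective. [folklore] -/
theorem injective_intEmbN : Injective (intEmbN G) := G.d₂.inr_injective

/-- `σ` is an open map. [folklore] -/
theorem isOpenMap_seamEmb : IsOpenMap (seamEmb G) := G.d₂.isOpenMap_inl.comp G.d₁.isOpenMap_inl

/-- `ι₁` is an open map. [folklore] -/
theorem isOpenMap_intEmbM : IsOpenMap (intEmbM G) := G.d₂.isOpenMap_inl.comp G.d₁.isOpenMap_inr

/-- `ι₂` is an open map. [folklore] -/
theorem isOpenMap_intEmbN : IsOpenMap (intEmbN G) := G.d₂.isOpenMap_inr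

/-- `σ` is smooth. [folklore] -/
theorem contMDiff_seamEmb :
    ContMDiff ((𝓡 n).prod 𝓘(ℝ, ℝ)) 𝓘(ℝ, EuclideanSpace ℝ (Fin (n + 1))) ∞ (seamEmb G) :=
  G.d₂.contMDiff_inl.comp G.d₁.contMDiff_inl

/-- `ι₁` is smooth. [folklore] -/
theorem contMDiff_intEmbM :
    ContMDiff 𝓘(ℝ, EuclideanSpace ℝ (Fin (n + 1))) 𝓘(ℝ, EuclideanSpace ℝ (Fin (n + 1))) ∞ (intEmbM G) :=
  G.d₂.contMDiff_inl.comp G.d₁.contMDiff_inr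

/-- `ι₂` is smooth. [folklore] -/
theorem contMDiff_intEmbN :
    ContMDiff 𝓘(ℝ, EuclideanSpace ℝ (Fin (n + 1))) 𝓘(ℝ, EuclideanSpace ℝ (Fin (n + 1))) ∞ (intEmbN G) :=
  G.d₂.contMDiff_inr

/-- The inverse of `σ` is smooth at the image points. [folklore] -/
theorem contMDiffAt_invFun_seamEmb (p : bM.carrier × ℝ) :
    ContMDiffAt 𝓘(ℝ, EuclideanSpace ℝ (Fin (n + 1))) ((𝓡 n).prod 𝓘(ℝ, ℝ)) ∞
      (Function.invFun (seamEmb G)) (seamEmb G p) := by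
  haveI : Nonempty G.d₁.Glued := ⟨G.d₁.inl p⟩
  exact contMDiffAt_invFun_comp G.d₁.inl_injective G.d₁.isOpenMap_inl G.d₂.inl_injective
    G.d₂.isOpenMap_inl (SmoothGlueData.contMDiffAt_invFun_inl G.d₁ p)
    (SmoothGlueData.contMDiffAt_invFun_inl G.d₂ (G.d₁.inl p))

/-- The inverse of `ι₁` is smooth at the image points. [folklore] -/
theorem contMDiffAt_invFun_intEmbM [Nonempty (InteriorManifold (𝓡∂ (n + 1)) M)]
    (a : InteriorManifold (𝓡∂ (n + 1)) M) :
    ContMDiffAt 𝓘(ℝ, EuclideanSpace ℝ (Fin (n + 1))) 𝓘(ℝ, EuclideanSpace ℝ (Fin (n + 1))) ∞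
      (Function.invFun (intEmbM G)) (intEmbM G a) := by
  haveI : Nonempty G.d₁.Glued := ⟨G.d₁.inr a⟩
  exact contMDiffAt_invFun_comp G.d₁.inr_injective G.d₁.isOpenMap_inr G.d₂.inl_injective
    G.d₂.isOpenMap_inl (SmoothGlueData.contMDiffAt_invFun_inr G.d₁ a)
    (SmoothGlueData.contMDiffAt_invFun_inl G.d₂ (G.d₁.inr a))

/-- The inverse of `ι₂` is smooth at the image points. [folklore] -/
theorem contMDiffAt_invFun_intEmbN [Nonempty (InteriorManifold (𝓡∂ (n + 1)) N)]
    (c : InteriorManifold (𝓡∂ (n + 1)) N) :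
    ContMDiffAt 𝓘(ℝ, EuclideanSpace ℝ (Fin (n + 1))) 𝓘(ℝ, EuclideanSpace ℝ (Fin (n + 1))) ∞
      (Function.invFun (intEmbN G)) (intEmbN G c) :=
  SmoothGlueData.contMDiffAt_invFun_inr G.d₂ c

/-- **The first gluing relation**: `σ (x, s) = ι₁ (CM x s)` for `s > 0`. [folklore] -/
theorem seamEmb_eq_intEmbM {p : bM.carrier × ℝ} (hp : 0 < p.2) :
    seamEmb G p = intEmbM G (G.CM.inPt p) := by
  have hsrc : p ∈ G.d₁.glue.source := hp
  rw [seamEmb_apply, intEmbM_apply, ← G.d₁.inr_glue hsrc]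
  rfl

/-- **The second gluing relation**: `σ (x, s) = ι₂ (CN (φ x) (-s))` for `s < 0`. [folklore] -/
theorem seamEmb_eq_intEmbN {p : bM.carrier × ℝ} (hp : p.2 < 0) :
    seamEmb G p = intEmbN G (G.CN.inPt (G.φ p.1, -p.2)) := by
  have hsrc : G.d₁.inl p ∈ G.d₂.glue.source := by
    rw [BoundaryGlueData.d₂_glue]; exact G.inl_mem_glue₂_source_iff.2 hp
  rw [seamEmb_apply, intEmbN_apply, ← G.d₂.inr_glue hsrc, BoundaryGlueData.d₂_glue, G.glue₂_inl]

/-- `jM` of a collar point is a seam point. [folklore] -/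
theorem jM_toFun_eq_seamEmb (z : bM.carrier) {t : ℝ} (ht : 0 ≤ t) :
    G.jM (G.CM.toFun z t) = seamEmb G (z, t) :=
  G.jM_toFun z ht

/-- `jN` of a collar point is a seam point. [folklore] -/
theorem jN_toFun_eq_seamEmb (z : bM.carrier) {s : ℝ} (hs : 0 ≤ s) :
    G.jN (G.CN.toFun (G.φ z) s) = seamEmb G (z, -s) :=
  G.jN_toFun z hs

/-- `jM` of an interior point. [folklore] -/
theorem jM_eq_intEmbM {a : M} (ha : (𝓡∂ (n + 1)).IsInteriorPoint a) :
    G.jM a = intEmbM G ⟨a, ha⟩ :=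
  G.jM_of_isInteriorPoint ha

/-- `jN` of an interior point. [folklore] -/
theorem jN_eq_intEmbN {c : N} (hc : (𝓡∂ (n + 1)).IsInteriorPoint c) :
    G.jN c = intEmbN G ⟨c, hc⟩ :=
  G.jN_of_isInteriorPoint hc

/-- **The three pieces cover `P`**: every point is a seam point, or an interior point of `M`
off the collar region, or an interior point of `N` off the collar region. [folklore] -/
theorem exists_seamEmb_or (q : G.d₂.Glued) :
    (∃ p, seamEmb G p = q) ∨
      (∃ a : InteriorManifold (𝓡∂ (n + 1)) M, a.val ∉ G.CM.region ∧ intEmbM G a = q) ∨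
      ∃ c : InteriorManifold (𝓡∂ (n + 1)) N, c.val ∉ G.CN.region ∧ intEmbN G c = q := by
  obtain (⟨x, rfl⟩ | ⟨y, rfl⟩) := G.d₂.exists_inl_or_inr q
  · obtain (⟨p, rfl⟩ | ⟨a, rfl⟩) := G.d₁.exists_inl_or_inr x
    · exact Or.inl ⟨p, rfl⟩
    · by_cases h : a.val ∈ G.CM.region
      · left
        refine ⟨G.CM.projHeight a.val, ?_⟩
        rw [seamEmb_apply, G.inl_projHeight_eq_inr h a.property]
      · exact Or.inr (Or.inl ⟨a, h, rfl⟩)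
  · by_cases h : y.val ∈ G.CN.region
    · left
      refine ⟨(G.φ.symm (G.CN.proj y.val), -G.CN.height y.val), ?_⟩
      rw [seamEmb_apply, G.inl_inl_eq_inr h y.property]
    · exact Or.inr (Or.inr ⟨y, h, rfl⟩)

/-- **The chart of `P` at a seam point**: the lift of the product chart of `∂M × ℝ` at `p`.
[folklore] -/
def seamChartP (p : bM.carrier × ℝ) : OpenPartialHomeomorph G.d₂.Glued (EuclideanSpace ℝ (Fin (n + 1))) :=
  G.d₂.chartA (G.d₁.chartA (chartAt (ModelProd (EuclideanSpace ℝ (Fin n)) ℝ) p))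

/-- The lifted chart is in the maximal atlas of `P`. [folklore] -/
theorem seamChartP_mem_maximalAtlas (p : bM.carrier × ℝ) :
    seamChartP G p ∈ IsManifold.maximalAtlas 𝓘(ℝ, EuclideanSpace ℝ (Fin (n + 1))) ∞ G.d₂.Glued :=
  IsManifold.subset_maximalAtlas
    (G.d₂.chartA_mem_atlas (IsManifold.subset_maximalAtlas
      (G.d₁.chartA_mem_atlas (IsManifold.chart_mem_maximalAtlas p))))

/-- The seam points over the chart domain lie in the source of the lifted chart. [folklore] -/
theorem seamEmb_mem_seamChartP_source {p p' : bM.carrier × ℝ}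
    (hp' : p' ∈ (chartAt (ModelProd (EuclideanSpace ℝ (Fin n)) ℝ) p).source) :
    seamEmb G p' ∈ (seamChartP G p).source := by
  rw [seamChartP, SmoothGlueData.chartA_source]
  exact ⟨G.d₁.inl p', by rw [SmoothGlueData.chartA_source]; exact mem_image_of_mem _ hp', rfl⟩

/-- **The lifted chart on seam points is the product chart followed by `consCLE`.** [folklore] -/
theorem seamChartP_seamEmb (p p' : bM.carrier × ℝ) :
    seamChartP G p (seamEmb G p') =
      BoundaryManifold.consCLE n (chartAt (EuclideanSpace ℝ (Fin n)) p.1 p'.1, p'.2) := by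
  rw [seamChartP, seamEmb_apply, SmoothGlueData.chartA_apply_inl, SmoothGlueData.chartA_apply_inl]
  rfl

end GlueMaps


/-! ### Pointwise pull-back calculus -/

section PullbackCalculus

variable {EA HA : Type*} [NormedAddCommGroup EA] [NormedSpace ℝ EA] [TopologicalSpace HA]
  {IA : ModelWithCorners ℝ EA HA}
  {EB HB : Type*} [NormedAddCommGroup EB] [NormedSpace ℝ EB] [TopologicalSpace HB]
  {IB : ModelWithCorners ℝ EB HB}
  {EP HP : Type*} [NormedAddCommGroup EP] [NormedSpace ℝ EP] [TopologicalSpace HP]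
  {IP : ModelWithCorners ℝ EP HP}
  {A : Type*} [TopologicalSpace A] [ChartedSpace HA A]
  {B : Type*} [TopologicalSpace B] [ChartedSpace HB B]
  {P : Type*} [TopologicalSpace P] [ChartedSpace HP P]
  {F : Type*} [NormedAddCommGroup F] [NormedSpace ℝ F] {k : ℕ}

/-- The pull-back at `x` only depends on the value of the form at `f x`. [folklore] -/
theorem MForm.pullback_congr_form {β β' : MForm IB B F k} {f : A → B} {x : A}
    (h : β (f x) = β' (f x)) : β.pullback IA f x = β'.pullback IA f x := by
  show (β (f x)).compContinuousLinearMap _ = (β' (f x)).compContinuousLinearMap _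
  rw [h]

/-- The pull-back at `x` only depends on the germ of the map at `x`. [folklore] -/
theorem MForm.pullback_congr_map (β : MForm IB B F k) {f f' : A → B} {x : A}
    (h : f =ᶠ[𝓝 x] f') : β.pullback IA f x = β.pullback IA f' x := by
  ext V
  rw [MForm.pullback_apply, MForm.pullback_apply, h.mfderiv_eq]
  exact MForm.apply_congr_point' β h.self_of_nhds _

/-- **Pointwise functoriality of the pull-back**: `f^*(g^*β) = (g ∘ f)^*β` at a point where both
maps are differentiable. [folklore] -/
theorem MForm.pullback_pullback_apply (β : MForm IP P F k) {g : B → P} {f : A → B} {x : A}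
    (hg : MDifferentiableAt IB IP g (f x)) (hf : MDifferentiableAt IA IB f x) :
    (β.pullback IB g).pullback IA f x = β.pullback IA (g ∘ f) x := by
  ext V
  simp only [MForm.pullback_apply, mfderiv_comp x hg hf]
  rfl

end PullbackCalculus

/-! ### The seam form read flat, for a general seam primitive -/

section SeamFlat

variable {H : Type*} [TopologicalSpace H] [ChartedSpace (EuclideanSpace ℝ (Fin 3)) H]
  [IsManifold (𝓡 3) ∞ H]

/-- `d` of a general fold primitive on `ℝ⁴`, as a manifold form, is the general fold model.
[folklore] -/
theorem mextDeriv_genFoldPrimitive (Φ : EuclideanSpace ℝ (Fin 4) → ℝ)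
    (b : EuclideanSpace ℝ (Fin 4) → EuclideanSpace ℝ (Fin 4) →L[ℝ] ℝ) (u : EuclideanSpace ℝ (Fin 4)) :
    mextDeriv (fun u => genFoldPrimitive Φ b u : MForm (𝓡 4) (EuclideanSpace ℝ (Fin 4)) ℝ 1) u =
      genContactFoldForm Φ b u :=
  mextDeriv_eq_extDeriv _ u

/-- **A `1`-form on `H × ℝ` whose flat representative over the chart at `h₀` is a general fold
primitive `Φ̂ b̂` has `dα = κ^*(d(Φ̂ b̂))` over the chart domain.** [cite: Baykur2006, proof of Thm. 6.1] -/
theorem mextDeriv_eq_pullback_of_flatRep {α : MForm ((𝓡 3).prod 𝓘(ℝ, ℝ)) (H × ℝ) ℝ 1} (h₀ : H)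
    {Φ : EuclideanSpace ℝ (Fin 4) → ℝ}
    {b : EuclideanSpace ℝ (Fin 4) → EuclideanSpace ℝ (Fin 4) →L[ℝ] ℝ}
    (hΦ : ContDiffOn ℝ ∞ Φ {u | sliceTail u ∈ (extChartAt (𝓡 3) h₀).target})
    (hb : ContDiffOn ℝ ∞ b {u | sliceTail u ∈ (extChartAt (𝓡 3) h₀).target})
    (hrep : ∀ u, sliceTail u ∈ (extChartAt (𝓡 3) h₀).target → flatRep α h₀ u = genFoldPrimitive Φ b u)
    {p : H × ℝ} (hp : p.1 ∈ (chartAt (EuclideanSpace ℝ (Fin 3)) h₀).source) :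
    mextDeriv α p =
      (genContactFoldForm Φ b).pullback ((𝓡 3).prod 𝓘(ℝ, ℝ)) (seamChart h₀) p := by
  set Gf : MForm (𝓡 4) (EuclideanSpace ℝ (Fin 4)) ℝ 1 := fun u => genFoldPrimitive Φ b u with hGf
  have hO := isOpen_sliceTail_preimage_target (H := H) h₀
  have ho : IsOpen ((chartAt (EuclideanSpace ℝ (Fin 3)) h₀).source ×ˢ (univ : Set ℝ)) :=
    (chartAt _ h₀).open_source.prod isOpen_univ
  -- `α = κ^* Gf` near `p`
  have hev : ∀ᶠ q in 𝓝 p, α q = Gf.pullback ((𝓡 3).prod 𝓘(ℝ, ℝ)) (seamChart h₀) q := by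
    filter_upwards [ho.mem_nhds ⟨hp, mem_univ _⟩] with q hq
    rw [eq_pullback_flatRep α h₀ hq.1]
    exact MForm.pullback_congr_form (hrep _ (seamChart_mem_preimage_target h₀ hq.1))
  refine (Literature.Geometry.Kaehler.mextDeriv_congr_of_eventuallyEq hev).trans ?_
  have hκ : ∀ᶠ q in 𝓝 p, ContMDiffAt ((𝓡 3).prod 𝓘(ℝ, ℝ)) (𝓡 4) ∞ (seamChart h₀) q := by
    filter_upwards [ho.mem_nhds ⟨hp, mem_univ _⟩] with q hq
    exact contMDiffAt_seamChart h₀ hq.1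
  have hτ : Gf.SmoothAt (seamChart h₀ p) := by
    refine (MForm.smoothAt_model_iff _ _).2 ?_
    have hlam : ContDiffOn ℝ ∞ (genFoldPrimitive Φ b)
        {u : EuclideanSpace ℝ (Fin 4) | sliceTail u ∈ (extChartAt (𝓡 3) h₀).target} :=
      hΦ.smul (covectorToOneForm.toContinuousLinearEquiv.contDiff.comp_contDiffOn hb)
    exact hlam.contDiffAt (hO.mem_nhds (seamChart_mem_preimage_target h₀ hp))
  rw [mextDeriv_pullback_apply hκ hτ]
  congr 1
  funext u
  exact mextDeriv_genFoldPrimitive Φ b u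

/-- **Off the fold of the flat model**: where the Pfaffian of `d(Φ̂ b̂)` is non-zero the flat model
has no kernel. [folklore] -/
theorem not_mem_fold_genContactFoldForm {Φ : EuclideanSpace ℝ (Fin 4) → ℝ}
    {b : EuclideanSpace ℝ (Fin 4) → EuclideanSpace ℝ (Fin 4) →L[ℝ] ℝ} {u : EuclideanSpace ℝ (Fin 4)}
    (h : pfaffian (genContactFoldForm Φ b u) ≠ 0) : u ∉ fold (genContactFoldForm Φ b) := by
  rintro ⟨v, hv, hvw⟩
  exact h ((pfaffian_eq_zero_iff _).2 ⟨v, hv, hvw⟩)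

end SeamFlat

/-! ### Def. 1 at the seam points of the glued manifold

If the glued form agrees near `σ p` with the push-forward of `dΛ` along the seam embedding, and
`Λ` reads flat over the chart at `p.1` as a general fold primitive `Φ̂ b̂`, then near `σ p` the
glued form is the pull-back of the flat model `d(Φ̂ b̂)` along a chart of `P` in the maximal
atlas; Def. 1 at `σ p` follows from the flat data at `κ p`. -/

section SeamZone

universe u

variable {M N : Type u} [TopologicalSpace M] [ChartedSpace (EuclideanHalfSpace 4) M]
  [TopologicalSpace N] [ChartedSpace (EuclideanHalfSpace 4) N]
  [IsManifold (𝓡∂ 4) ∞ M] [IsManifold (𝓡∂ 4) ∞ N]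
  {bM : BoundaryData (𝓡∂ 4) M (𝓡 3)} {bN : BoundaryData (𝓡∂ 4) N (𝓡 3)}
  (G : BoundaryGlueData bM bN) [Nonempty bM.carrier]

/-- The lifted chart at a seam point, on seam points over the chart domain, is the product
chart `κ_{p.1}` of the seam piece. [folklore] -/
theorem seamChartP_seamEmb_eq_seamChart (p p' : bM.carrier × ℝ) :
    seamChartP G p (seamEmb G p') = seamChart p.1 p' := by
  rw [seamChartP_seamEmb, seamChart, extChartAt_R3_eq_chartAt]

/-- **Near a seam point the push-forward of `dΛ` is the pull-back of the flat model along the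
lifted chart.** [cite: Baykur2006, proof of Thm. 6.1] -/
theorem pullback_invFun_seamEmb_eventuallyEq {Λ : MForm ((𝓡 3).prod 𝓘(ℝ, ℝ)) (bM.carrier × ℝ) ℝ 1}
    (p : bM.carrier × ℝ) {Φ : EuclideanSpace ℝ (Fin 4) → ℝ}
    {b : EuclideanSpace ℝ (Fin 4) → EuclideanSpace ℝ (Fin 4) →L[ℝ] ℝ}
    (hΦ : ContDiffOn ℝ ∞ Φ {u | sliceTail u ∈ (extChartAt (𝓡 3) p.1).target})
    (hb : ContDiffOn ℝ ∞ b {u | sliceTail u ∈ (extChartAt (𝓡 3) p.1).target})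
    (hrep : ∀ u, sliceTail u ∈ (extChartAt (𝓡 3) p.1).target →
      flatRep Λ p.1 u = genFoldPrimitive Φ b u) :
    ∀ᶠ q in 𝓝 (seamEmb G p), ((mextDeriv Λ).pullback (𝓡 4) (Function.invFun (seamEmb G))) q =
      ((genContactFoldForm Φ b).pullback (𝓡 4) (seamChartP G p)) q := by
  have hinj := injective_seamEmb G
  have hopen := isOpenMap_seamEmb G
  have hsm := contMDiff_seamEmb G
  have hinv := contMDiffAt_invFun_seamEmb G
  -- the neighbourhood `(seamEmb G) (chart domain × ℝ)`
  have ho : IsOpen ((chartAt (EuclideanSpace ℝ (Fin 3)) p.1).source ×ˢ (univ : Set ℝ)) :=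
    (chartAt _ p.1).open_source.prod isOpen_univ
  have hpo : p ∈ (chartAt (EuclideanSpace ℝ (Fin 3)) p.1).source ×ˢ (univ : Set ℝ) :=
    ⟨mem_chart_source _ p.1, mem_univ _⟩
  filter_upwards [(hopen _ ho).mem_nhds (mem_image_of_mem (seamEmb G) hpo)] with q hq
  obtain ⟨p', hp', rfl⟩ := hq
  -- `(seamChartP G p)` is smooth near `(seamEmb G) p'` and `(seamChartP G p) ∘ (seamEmb G) = κ` near `p'`
  have hφPs : ContMDiffAt (𝓡 4) (𝓡 4) ∞ (seamChartP G p) ((seamEmb G) p') := by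
    have hsrc : (seamEmb G) p' ∈ (seamChartP G p).source := by
      refine seamEmb_mem_seamChartP_source G ?_
      rw [prodChartedSpace_chartAt, OpenPartialHomeomorph.prod_source]
      exact ⟨hp'.1, by simp⟩
    exact (contMDiffOn_of_mem_maximalAtlas (seamChartP_mem_maximalAtlas G p)).contMDiffAt
      ((seamChartP G p).open_source.mem_nhds hsrc)
  have hcomp : ((seamChartP G p) ∘ (seamEmb G)) = seamChart p.1 := funext fun p'' => seamChartP_seamEmb_eq_seamChart G p p''
  -- `dΛ = ((seamChartP G p) ∘ (seamEmb G))^* (flat model)` at `p'`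
  have h1 : mextDeriv Λ p' = (genContactFoldForm Φ b).pullback ((𝓡 3).prod 𝓘(ℝ, ℝ)) ((seamChartP G p) ∘ (seamEmb G)) p' := by
    rw [hcomp]; exact mextDeriv_eq_pullback_of_flatRep p.1 hΦ hb hrep hp'.1
  -- evaluate the push-forward at `(seamEmb G) p'`
  have hval : Function.invFun (seamEmb G) ((seamEmb G) p') = p' := Function.leftInverse_invFun hinj p'
  have h2 : ((mextDeriv Λ).pullback (𝓡 4) (Function.invFun (seamEmb G))) ((seamEmb G) p') =
      (((genContactFoldForm Φ b).pullback ((𝓡 3).prod 𝓘(ℝ, ℝ)) ((seamChartP G p) ∘ (seamEmb G))).pullback (𝓡 4)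
        (Function.invFun (seamEmb G))) ((seamEmb G) p') := by
    refine MForm.pullback_congr_form ?_
    rw [hval]; exact h1
  have hdiffσ : MDifferentiableAt (𝓡 4) ((𝓡 3).prod 𝓘(ℝ, ℝ)) (Function.invFun (seamEmb G)) ((seamEmb G) p') :=
    (hinv p').mdifferentiableAt (by simp)
  have hdiffc : MDifferentiableAt ((𝓡 3).prod 𝓘(ℝ, ℝ)) (𝓡 4) ((seamChartP G p) ∘ (seamEmb G)) (Function.invFun (seamEmb G) ((seamEmb G) p')) := by
    rw [hval]
    exact (hφPs.comp p' (hsm p')).mdifferentiableAt (by simp)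
  have h3 := MForm.pullback_pullback_apply (IA := 𝓡 4) (genContactFoldForm Φ b) hdiffc hdiffσ
  have h4 : (((seamChartP G p) ∘ (seamEmb G)) ∘ Function.invFun (seamEmb G)) =ᶠ[𝓝 ((seamEmb G) p')] (seamChartP G p) := by
    filter_upwards [hopen.isOpen_range.mem_nhds (mem_range_self p')] with q hq
    obtain ⟨p'', rfl⟩ := hq
    show (seamChartP G p) ((seamEmb G) (Function.invFun (seamEmb G) ((seamEmb G) p''))) = (seamChartP G p) ((seamEmb G) p'')
    rw [Function.leftInverse_invFun hinj p'']
  have h5 : (genContactFoldForm Φ b).pullback (𝓡 4) (((seamChartP G p) ∘ (seamEmb G)) ∘ Function.invFun (seamEmb G)) ((seamEmb G) p') =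
      (genContactFoldForm Φ b).pullback (𝓡 4) (seamChartP G p) ((seamEmb G) p') :=
    MForm.pullback_congr_map (IA := 𝓡 4) (genContactFoldForm Φ b) h4
  have key : ((mextDeriv Λ).pullback (𝓡 4) (Function.invFun (seamEmb G))) (seamEmb G p') =
      ((genContactFoldForm Φ b).pullback (𝓡 4) (seamChartP G p)) (seamEmb G p') :=
    (h2.trans h3).trans h5
  exact key

/-- **Def. 1 at a seam point** (the clause of `def_one_of_locally` at `σ p`): if the glued form
agrees near `σ p` with the push-forward of `dΛ`, `Λ` reads flat over the chart at `p.1` as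
`Φ̂ b̂` with `b̂ ⟂ e₀`, and at `u = κ p` either the fold data (`∂₀Φ̂ = 0`, `Φ̂ ≠ 0`, `∂₀∂₀Φ̂ ≠ 0`,
`b̂ ∧ db̂ ≠ 0`) or the symplectic data (`Pf ≠ 0`) hold, then the germ of the glued form at `σ p`
is that of a smooth closed form satisfying Def. 1 at `σ p`. [cite: Baykur2006, proof of Thm. 6.1] -/
theorem def_one_germ_seamEmb {s : MForm (𝓡 4) G.d₂.Glued ℝ 2}
    {Λ : MForm ((𝓡 3).prod 𝓘(ℝ, ℝ)) (bM.carrier × ℝ) ℝ 1} (p : bM.carrier × ℝ)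
    {Φ : EuclideanSpace ℝ (Fin 4) → ℝ}
    {b : EuclideanSpace ℝ (Fin 4) → EuclideanSpace ℝ (Fin 4) →L[ℝ] ℝ}
    (hΦ : ContDiffOn ℝ ∞ Φ {u | sliceTail u ∈ (extChartAt (𝓡 3) p.1).target})
    (hb : ContDiffOn ℝ ∞ b {u | sliceTail u ∈ (extChartAt (𝓡 3) p.1).target})
    (hb0 : ∀ u, sliceTail u ∈ (extChartAt (𝓡 3) p.1).target → b u (stdVec 0) = 0)
    (hb1 : ∀ u, sliceTail u ∈ (extChartAt (𝓡 3) p.1).target → fderiv ℝ b u (stdVec 0) = 0)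
    (hrep : ∀ u, sliceTail u ∈ (extChartAt (𝓡 3) p.1).target →
      flatRep Λ p.1 u = genFoldPrimitive Φ b u)
    (hs : ∀ᶠ q in 𝓝 (seamEmb G p),
      s q = ((mextDeriv Λ).pullback (𝓡 4) (Function.invFun (seamEmb G))) q)
    (hcase : (fderiv ℝ Φ (seamChart p.1 p) (stdVec 0) = 0 ∧ Φ (seamChart p.1 p) ≠ 0 ∧
        fderiv ℝ (fun y => fderiv ℝ Φ y (stdVec 0)) (seamChart p.1 p) (stdVec 0) ≠ 0 ∧
        sliceContactVolume (b (seamChart p.1 p)) (fderiv ℝ b (seamChart p.1 p)) ≠ 0) ∨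
      pfaffian (genContactFoldForm Φ b (seamChart p.1 p)) ≠ 0) :
    ∃ s' : MForm (𝓡 4) G.d₂.Glued ℝ 2, (∀ᶠ q in 𝓝 (seamEmb G p), s q = s' q) ∧
      s'.SmoothAt (seamEmb G p) ∧ mextDeriv s' (seamEmb G p) = 0 ∧
      (seamEmb G p ∈ fold s' →
        fderiv ℝ (fun y => pfaffian (s'.inChart (seamEmb G p) y))
            (extChartAt (𝓡 4) (seamEmb G p) (seamEmb G p)) ≠ 0 ∧
          ∃ v : TangentSpace (𝓡 4) (seamEmb G p), (∀ w, s' (seamEmb G p) ![v, w] = 0) ∧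
            fderiv ℝ (fun y => pfaffian (s'.inChart (seamEmb G p) y))
              (extChartAt (𝓡 4) (seamEmb G p) (seamEmb G p)) v ≠ 0) := by
  set z := seamEmb G p with hz
  set φP := seamChartP G p with hφP
  let t : MForm (𝓡 4) (EuclideanSpace ℝ (Fin 4)) ℝ 2 := genContactFoldForm Φ b
  let s' : MForm (𝓡 4) G.d₂.Glued ℝ 2 := t.pullback (𝓡 4) φP
  have hO := isOpen_sliceTail_preimage_target (H := bM.carrier) p.1
  have hφz : φP z = seamChart p.1 p := seamChartP_seamEmb_eq_seamChart G p p
  have hzO : φP z ∈ {u | sliceTail u ∈ (extChartAt (𝓡 3) p.1).target} := by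
    rw [hφz]; exact seamChart_mem_preimage_target p.1 (mem_chart_source _ p.1)
  have hmax := seamChartP_mem_maximalAtlas G p
  have hzsrc : z ∈ φP.source := by
    refine seamEmb_mem_seamChartP_source G ?_
    exact mem_chart_source _ p
  -- the germ
  have hgerm : ∀ᶠ q in 𝓝 z, s q = s' q := by
    filter_upwards [hs, pullback_invFun_seamEmb_eventuallyEq G p hΦ hb hrep] with q h1 h2
    exact h1.trans h2
  -- smoothness of `s'` at `z`
  have hφPs : ∀ᶠ q in 𝓝 z, ContMDiffAt (𝓡 4) (𝓡 4) ∞ φP q := by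
    filter_upwards [φP.open_source.mem_nhds hzsrc] with q hq
    exact (contMDiffOn_of_mem_maximalAtlas hmax).contMDiffAt (φP.open_source.mem_nhds hq)
  have hts : t.SmoothAt (φP z) := smoothAt_genContactFoldForm hO hΦ hb hzO
  have hsm : s'.SmoothAt z := MForm.SmoothAt.pullback hφPs hts
  -- closedness of `s'` at `z`
  have hcl : mextDeriv s' z = 0 := by
    have h := mextDeriv_pullback_apply hφPs hts
    have h0 : mextDeriv t (φP z) = 0 := mextDeriv_genContactFoldForm_eq_zero hO hΦ hb hzO
    refine h.trans ?_
    ext V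
    rw [MForm.pullback_apply, h0]
    rfl
  refine ⟨s', hgerm, hsm, hcl, fun hfold => ?_⟩
  rcases hcase with ⟨hcrit, hΦz0, hΦ2, hvol⟩ | hpf
  · rw [← hφz] at hcrit hΦz0 hΦ2 hvol
    obtain ⟨-, htr, hker⟩ := def_one_at_of_chart_genContactFoldForm (s := s') hmax hzsrc hO hΦ hb
      (fun y hy => hb0 y hy) (fun y hy => hb1 y hy) hzO (Eventually.of_forall fun _ => rfl)
      hcrit hΦz0 hΦ2 hvol
    exact ⟨htr, hker⟩
  · exfalso
    rw [← hφz] at hpf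
    have hon : ContMDiffOn (𝓡 4) (𝓡 4) ∞ φP φP.source := contMDiffOn_of_mem_maximalAtlas hmax
    have hmd : φP.MDifferentiable (𝓡 4) (𝓡 4) :=
      ⟨hon.mdifferentiableOn (by simp),
        (contMDiffOn_symm_of_mem_maximalAtlas hmax).mdifferentiableOn (by simp)⟩
    have hbij : Bijective (mfderiv (𝓡 4) (𝓡 4) φP z) := hmd.mfderiv_bijective hzsrc
    refine not_mem_fold_pullback t φP (not_mem_fold_genContactFoldForm hpf) (fun v hv h0 => hv ?_) hfold
    exact hbij.1 (h0.trans (map_zero _).symm)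

end SeamZone


/-! ### Def. 1 at interior points: push-forwards of closed non-degenerate forms -/

section InteriorZone

variable {A : Type*} [TopologicalSpace A] [ChartedSpace (EuclideanSpace ℝ (Fin 4)) A]
  [IsManifold (𝓡 4) ∞ A]
  {P : Type*} [TopologicalSpace P] [ChartedSpace (EuclideanSpace ℝ (Fin 4)) P]
  [IsManifold (𝓡 4) ∞ P] [Nonempty A] {f : A → P}

/-- **Def. 1 at an image point of an injective open smooth map with smooth inverse**, where the
glued form agrees with the push-forward of a smooth closed non-degenerate `2`-form: the germ is
that of a smooth closed form with no fold at the point. [folklore] -/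
theorem def_one_germ_pushforward (hinj : Injective f) (hopen : IsOpenMap f)
    (hf : ContMDiff (𝓡 4) (𝓡 4) ∞ f) (hinv : ∀ a, ContMDiffAt (𝓡 4) (𝓡 4) ∞ (Function.invFun f) (f a))
    {τ : MForm (𝓡 4) A ℝ 2} (hτs : IsSmoothForm τ) (hτc : ∀ a, mextDeriv τ a = 0)
    (hτn : ∀ (a : A) (v : EuclideanSpace ℝ (Fin 4)), v ≠ 0 →
      ∃ w : EuclideanSpace ℝ (Fin 4), τ a ![v, w] ≠ 0)
    {s : MForm (𝓡 4) P ℝ 2} {a : A}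
    (hs : ∀ᶠ q in 𝓝 (f a), s q = (τ.pullback (𝓡 4) (Function.invFun f)) q) :
    ∃ s' : MForm (𝓡 4) P ℝ 2, (∀ᶠ q in 𝓝 (f a), s q = s' q) ∧
      s'.SmoothAt (f a) ∧ mextDeriv s' (f a) = 0 ∧
      (f a ∈ fold s' →
        fderiv ℝ (fun y => pfaffian (s'.inChart (f a) y)) (extChartAt (𝓡 4) (f a) (f a)) ≠ 0 ∧
          ∃ v : TangentSpace (𝓡 4) (f a), (∀ w, s' (f a) ![v, w] = 0) ∧
            fderiv ℝ (fun y => pfaffian (s'.inChart (f a) y)) (extChartAt (𝓡 4) (f a) (f a)) v ≠ 0) := by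
  have hτa : τ.SmoothAt a := (isSmoothForm_iff_smoothAt τ).1 hτs a
  refine ⟨τ.pullback (𝓡 4) (Function.invFun f), hs, smoothAt_pullback_invFun hinj hopen hinv hτa,
    ?_, fun hfold => ?_⟩
  · rw [mextDeriv_pullback_invFun hinj hopen hinv hτa]
    have h0 : (mextDeriv τ) (Function.invFun f (f a)) = (0 : MForm (𝓡 4) A ℝ 3) (Function.invFun f (f a)) :=
      hτc _
    rw [MForm.pullback_congr_form (IA := 𝓡 4) h0, MForm.pullback_zero]
    rfl
  · exfalso
    have ha : a ∉ fold τ := fun ⟨v, hv, h⟩ => by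
      obtain ⟨w, hw⟩ := hτn a v hv
      exact hw (h w)
    exact not_mem_fold_pullback_invFun hinj hopen hf hinv ha hfold

end InteriorZone

/-! ### The glued form and its three regions -/

section ShortCollar

universe u

variable {M : Type u} [TopologicalSpace M] [ChartedSpace (EuclideanHalfSpace 4) M]
  {b : BoundaryData (𝓡∂ 4) M (𝓡 3)}

/-- The short collar `C (H × [0, 2δ])` is closed (for compact `H`). [folklore] -/
theorem isClosed_shortCollar [T2Space M] [CompactSpace b.carrier] (C : b.OpenCollar) (δ : ℝ) :
    IsClosed (uncurry C.toFun '' (univ ×ˢ Icc 0 (2 * δ))) := by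
  have hK : IsCompact ((univ : Set b.carrier) ×ˢ Icc (0 : ℝ) (2 * δ)) :=
    isCompact_univ.prod isCompact_Icc
  refine (hK.image_of_continuousOn (C.continuousOn_toFun.mono ?_)).isClosed
  exact prod_mono (subset_refl _) Icc_subset_Ici_self

/-- A collar point off the short collar has parameter `> 2δ`. [folklore] -/
theorem lt_of_toFun_not_mem_shortCollar (C : b.OpenCollar) {δ : ℝ} {x : b.carrier} {t : ℝ}
    (ht : 0 ≤ t) (h : C.toFun x t ∉ uncurry C.toFun '' (univ ×ˢ Icc 0 (2 * δ))) : 2 * δ < t := by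
  by_contra hle
  exact h ⟨(x, t), ⟨mem_univ _, ht, not_lt.1 hle⟩, rfl⟩

/-- A collar point with parameter `> 2δ` is off the short collar. [folklore] -/
theorem toFun_not_mem_shortCollar (C : b.OpenCollar) {δ : ℝ} {x : b.carrier} {t : ℝ}
    (ht : 2 * δ < t) (ht0 : 0 ≤ t) : C.toFun x t ∉ uncurry C.toFun '' (univ ×ˢ Icc 0 (2 * δ)) := by
  rintro ⟨⟨x', t'⟩, ⟨-, ht'0, ht'⟩, hxt⟩
  have h := (C.eq_of_apply_eq ht'0 ht0 hxt).2
  simp only at h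
  linarith

/-- The short collar contains the collar region's complement's complement: points off the
collar region are off the short collar. [folklore] -/
theorem not_mem_shortCollar_of_not_mem_region (C : b.OpenCollar) {δ : ℝ} {z : M}
    (hz : z ∉ C.region) : z ∉ uncurry C.toFun '' (univ ×ˢ Icc 0 (2 * δ)) := by
  rintro ⟨⟨x, t⟩, ⟨-, ht0, -⟩, hxt⟩
  exact hz (hxt ▸ C.mem_region x t ht0)

end ShortCollar

section GluedForm

universe u

variable {M N : Type u} [TopologicalSpace M] [ChartedSpace (EuclideanHalfSpace 4) M]
  [TopologicalSpace N] [ChartedSpace (EuclideanHalfSpace 4) N]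
  [IsManifold (𝓡∂ 4) ∞ M] [IsManifold (𝓡∂ 4) ∞ N]
  {bM : BoundaryData (𝓡∂ 4) M (𝓡 3)} {bN : BoundaryData (𝓡∂ 4) N (𝓡 3)}
  (G : BoundaryGlueData bM bN) [Nonempty bM.carrier]

/-- The seam zone `σ (H × (-3δ, 3δ))` of the glued manifold. [folklore] -/
def seamZone (δ : ℝ) : Set G.d₂.Glued := seamEmb G '' (univ ×ˢ Ioo (-(3 * δ)) (3 * δ))

/-- The seam zone is open. [folklore] -/
theorem isOpen_seamZone (δ : ℝ) : IsOpen (seamZone G δ) :=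
  isOpenMap_seamEmb G _ (isOpen_univ.prod isOpen_Ioo)

/-- Membership of a seam point in the seam zone. [folklore] -/
theorem seamEmb_mem_seamZone_iff {δ : ℝ} {p : bM.carrier × ℝ} :
    seamEmb G p ∈ seamZone G δ ↔ -(3 * δ) < p.2 ∧ p.2 < 3 * δ := by
  constructor
  · rintro ⟨p', hp', h⟩
    rw [injective_seamEmb G h] at hp'
    exact hp'.2
  · exact fun h => ⟨p, ⟨mem_univ _, h⟩, rfl⟩

/-- The interiors of the two pieces are disjoint in `P`. [folklore] -/
theorem intEmbM_ne_intEmbN (a : InteriorManifold (𝓡∂ 4) M) (c : InteriorManifold (𝓡∂ 4) N) :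
    intEmbM G a ≠ intEmbN G c :=
  G.inl_inr_ne_inr a c

/-- A seam point in the interior of the first piece has positive collar parameter. [folklore] -/
theorem pos_of_seamEmb_eq_intEmbM {p : bM.carrier × ℝ} {a : InteriorManifold (𝓡∂ 4) M}
    (h : seamEmb G p = intEmbM G a) : 0 < p.2 := by
  rcases lt_trichotomy p.2 0 with hneg | hzero | hpos
  · rw [seamEmb_eq_intEmbN G hneg] at h
    exact absurd h.symm (intEmbM_ne_intEmbN G a _)
  · exfalso
    have h' : G.d₂.inl (G.d₁.inl (p.1, 0)) = G.d₂.inl (G.d₁.inr a) := by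
      rw [← hzero]; exact h
    exact G.inl_zero_ne_inr p.1 a (G.d₂.inl_injective h')
  · exact hpos

/-- A seam point in the interior of the second piece has negative collar parameter. [folklore] -/
theorem neg_of_seamEmb_eq_intEmbN {p : bM.carrier × ℝ} {c : InteriorManifold (𝓡∂ 4) N}
    (h : seamEmb G p = intEmbN G c) : p.2 < 0 := by
  rcases lt_trichotomy p.2 0 with hneg | hzero | hpos
  · exact hneg
  · exfalso
    have h' : G.d₂.inl (G.d₁.inl (p.1, 0)) = G.d₂.inr c := by
      rw [← hzero]; exact h
    exact G.inl_inl_zero_ne_inr p.1 c h'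
  · rw [seamEmb_eq_intEmbM G hpos] at h
    exact absurd h (intEmbM_ne_intEmbN G _ c)

/-- **Every point of `P` is in the seam zone, or an interior point of a piece off its short
collar.** [folklore] -/
theorem mem_seamZone_or {δ : ℝ} (hδ : 0 < δ) (q : G.d₂.Glued) :
    (∃ p, -(3 * δ) < p.2 ∧ p.2 < 3 * δ ∧ seamEmb G p = q) ∨
      (∃ a : InteriorManifold (𝓡∂ 4) M,
        a.val ∉ uncurry G.CM.toFun '' (univ ×ˢ Icc 0 (2 * δ)) ∧ intEmbM G a = q) ∨
      ∃ c : InteriorManifold (𝓡∂ 4) N,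
        c.val ∉ uncurry G.CN.toFun '' (univ ×ˢ Icc 0 (2 * δ)) ∧ intEmbN G c = q := by
  haveI : Nonempty bN.carrier := Nonempty.map G.φ inferInstance
  rcases exists_seamEmb_or G q with ⟨p, rfl⟩ | ⟨a, ha, rfl⟩ | ⟨c, hc, rfl⟩
  · by_cases h1 : p.2 < 3 * δ
    · by_cases h2 : -(3 * δ) < p.2
      · exact Or.inl ⟨p, h2, h1, rfl⟩
      · right; right
        have hneg : p.2 < 0 := by linarith
        refine ⟨G.CN.inPt (G.φ p.1, -p.2), ?_, (seamEmb_eq_intEmbN G hneg).symm⟩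
        rw [G.CN.inPt_val (p := (G.φ p.1, -p.2)) (by simpa using hneg)]
        exact toFun_not_mem_shortCollar G.CN (by simp only; linarith) (by simp only; linarith)
    · right; left
      have hpos : 0 < p.2 := by linarith
      refine ⟨G.CM.inPt p, ?_, (seamEmb_eq_intEmbM G hpos).symm⟩
      rw [G.CM.inPt_val hpos]
      exact toFun_not_mem_shortCollar G.CM (by linarith) hpos.le
  · exact Or.inr (Or.inl ⟨a, not_mem_shortCollar_of_not_mem_region G.CM ha, rfl⟩)
  · exact Or.inr (Or.inr ⟨c, not_mem_shortCollar_of_not_mem_region G.CN hc, rfl⟩)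

variable [Nonempty (InteriorManifold (𝓡∂ 4) M)] [Nonempty (InteriorManifold (𝓡∂ 4) N)]

open Classical in
/-- **The glued `2`-form** on `P = W₁ ∪ (H × ℝ) ∪ W₂`: the push-forward of `dΛ` on the seam zone,
of `τM` on the rest of the interior of the first piece and of `τN` on the rest of the interior of
the second piece. [cite: Baykur2006, proof of Thm. 6.1] -/
def gluedForm (δ : ℝ) (Λ : MForm ((𝓡 3).prod 𝓘(ℝ, ℝ)) (bM.carrier × ℝ) ℝ 1)
    (τM : MForm (𝓡 4) (InteriorManifold (𝓡∂ 4) M) ℝ 2)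
    (τN : MForm (𝓡 4) (InteriorManifold (𝓡∂ 4) N) ℝ 2) : MForm (𝓡 4) G.d₂.Glued ℝ 2 := fun q =>
  if q ∈ seamZone G δ then ((mextDeriv Λ).pullback (𝓡 4) (Function.invFun (seamEmb G))) q
  else if q ∈ range (intEmbM G) then (τM.pullback (𝓡 4) (Function.invFun (intEmbM G))) q
  else (τN.pullback (𝓡 4) (Function.invFun (intEmbN G))) q

variable {δ : ℝ} {Λ : MForm ((𝓡 3).prod 𝓘(ℝ, ℝ)) (bM.carrier × ℝ) ℝ 1}
  {τM : MForm (𝓡 4) (InteriorManifold (𝓡∂ 4) M) ℝ 2}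
  {τN : MForm (𝓡 4) (InteriorManifold (𝓡∂ 4) N) ℝ 2}

/-- The glued form on the seam zone. [folklore] -/
theorem gluedForm_of_mem_seamZone {q : G.d₂.Glued} (hq : q ∈ seamZone G δ) :
    gluedForm G δ Λ τM τN q = ((mextDeriv Λ).pullback (𝓡 4) (Function.invFun (seamEmb G))) q := by
  simp only [gluedForm, hq, if_true]

/-- The glued form off the seam zone, on the interior of the first piece. [folklore] -/
theorem gluedForm_of_mem_range_intEmbM {q : G.d₂.Glued} (hq : q ∉ seamZone G δ)
    (hq' : q ∈ range (intEmbM G)) :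
    gluedForm G δ Λ τM τN q = (τM.pullback (𝓡 4) (Function.invFun (intEmbM G))) q := by
  simp only [gluedForm, hq, if_false, hq', if_true]

/-- The glued form off the seam zone and off the interior of the first piece. [folklore] -/
theorem gluedForm_of_not_mem {q : G.d₂.Glued} (hq : q ∉ seamZone G δ)
    (hq' : q ∉ range (intEmbM G)) :
    gluedForm G δ Λ τM τN q = (τN.pullback (𝓡 4) (Function.invFun (intEmbN G))) q := by
  simp only [gluedForm, hq, if_false, hq']

/-- The glued form near a point of the seam zone. [folklore] -/
theorem gluedForm_eventuallyEq_seamEmb {p : bM.carrier × ℝ} (hp : -(3 * δ) < p.2 ∧ p.2 < 3 * δ) :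
    ∀ᶠ q in 𝓝 (seamEmb G p),
      gluedForm G δ Λ τM τN q = ((mextDeriv Λ).pullback (𝓡 4) (Function.invFun (seamEmb G))) q := by
  filter_upwards [(isOpen_seamZone G δ).mem_nhds ((seamEmb_mem_seamZone_iff G).2 hp)] with q hq
  exact gluedForm_of_mem_seamZone G hq

/-- **The glued form near an interior point of the first piece off the short collar is the
push-forward of `τM`**, provided the push-forwards of `dΛ` and `τM` agree on the seam points
with parameter in `(2δ, 3δ)`. [cite: Baykur2006, proof of Thm. 6.1] -/
theorem gluedForm_eventuallyEq_intEmbM [T2Space M] [CompactSpace bM.carrier]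
    (hC : ∀ p : bM.carrier × ℝ, 2 * δ < p.2 → p.2 < 3 * δ →
      ((mextDeriv Λ).pullback (𝓡 4) (Function.invFun (seamEmb G))) (seamEmb G p) =
        (τM.pullback (𝓡 4) (Function.invFun (intEmbM G))) (seamEmb G p))
    {a : InteriorManifold (𝓡∂ 4) M}
    (ha : a.val ∉ uncurry G.CM.toFun '' (univ ×ˢ Icc 0 (2 * δ))) :
    ∀ᶠ q in 𝓝 (intEmbM G a),
      gluedForm G δ Λ τM τN q = (τM.pullback (𝓡 4) (Function.invFun (intEmbM G))) q := by
  have hU : IsOpen (intEmbM G '' {a' : InteriorManifold (𝓡∂ 4) M |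
      a'.val ∉ uncurry G.CM.toFun '' (univ ×ˢ Icc 0 (2 * δ))}) := by
    refine isOpenMap_intEmbM G _ ?_
    exact (isClosed_shortCollar G.CM δ).isOpen_compl.preimage InteriorManifold.continuous_val
  filter_upwards [hU.mem_nhds ⟨a, ha, rfl⟩] with q hq
  obtain ⟨a', ha', rfl⟩ := hq
  by_cases hZ : intEmbM G a' ∈ seamZone G δ
  · obtain ⟨p, hp, hpq⟩ := hZ
    have hpos : 0 < p.2 := pos_of_seamEmb_eq_intEmbM G hpq
    have ha'p : a' = G.CM.inPt p := injective_intEmbM G (hpq.symm.trans (seamEmb_eq_intEmbM G hpos))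
    have hval : a'.val = G.CM.toFun p.1 p.2 := by rw [ha'p]; exact G.CM.inPt_val hpos
    have h2δ : 2 * δ < p.2 := by
      refine lt_of_toFun_not_mem_shortCollar G.CM (x := p.1) hpos.le ?_
      rw [← hval]; exact ha'
    rw [gluedForm_of_mem_seamZone G ⟨p, hp, hpq⟩, ← hpq]
    exact hC p h2δ hp.2.2
  · exact gluedForm_of_mem_range_intEmbM G hZ (mem_range_self a')

/-- **The glued form near an interior point of the second piece off the short collar is the
push-forward of `τN`**, provided the push-forwards of `dΛ` and `τN` agree on the seam points
with parameter in `(-3δ, -2δ)`. [cite: Baykur2006, proof of Thm. 6.1] -/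
theorem gluedForm_eventuallyEq_intEmbN [T2Space N] [CompactSpace bN.carrier]
    (hC : ∀ p : bM.carrier × ℝ, -(3 * δ) < p.2 → p.2 < -(2 * δ) →
      ((mextDeriv Λ).pullback (𝓡 4) (Function.invFun (seamEmb G))) (seamEmb G p) =
        (τN.pullback (𝓡 4) (Function.invFun (intEmbN G))) (seamEmb G p))
    {c : InteriorManifold (𝓡∂ 4) N}
    (hc : c.val ∉ uncurry G.CN.toFun '' (univ ×ˢ Icc 0 (2 * δ))) :
    ∀ᶠ q in 𝓝 (intEmbN G c),
      gluedForm G δ Λ τM τN q = (τN.pullback (𝓡 4) (Function.invFun (intEmbN G))) q := by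
  haveI : Nonempty bN.carrier := Nonempty.map G.φ inferInstance
  have hU : IsOpen (intEmbN G '' {c' : InteriorManifold (𝓡∂ 4) N |
      c'.val ∉ uncurry G.CN.toFun '' (univ ×ˢ Icc 0 (2 * δ))}) := by
    refine isOpenMap_intEmbN G _ ?_
    exact (isClosed_shortCollar G.CN δ).isOpen_compl.preimage InteriorManifold.continuous_val
  filter_upwards [hU.mem_nhds ⟨c, hc, rfl⟩] with q hq
  obtain ⟨c', hc', rfl⟩ := hq
  have hnot : intEmbN G c' ∉ range (intEmbM G) := by
    rintro ⟨a, ha⟩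
    exact intEmbM_ne_intEmbN G a c' ha
  by_cases hZ : intEmbN G c' ∈ seamZone G δ
  · obtain ⟨p, hp, hpq⟩ := hZ
    have hneg : p.2 < 0 := neg_of_seamEmb_eq_intEmbN G hpq
    have hc'p : c' = G.CN.inPt (G.φ p.1, -p.2) :=
      injective_intEmbN G (hpq.symm.trans (seamEmb_eq_intEmbN G hneg))
    have hval : c'.val = G.CN.toFun (G.φ p.1) (-p.2) := by
      rw [hc'p]; exact G.CN.inPt_val (p := (G.φ p.1, -p.2)) (by simpa using hneg)
    have h2δ : 2 * δ < -p.2 := by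
      refine lt_of_toFun_not_mem_shortCollar G.CN (x := G.φ p.1) (by linarith) ?_
      rw [← hval]; exact hc'
    rw [gluedForm_of_mem_seamZone G ⟨p, hp, hpq⟩, ← hpq]
    exact hC p hp.2.1 (by linarith)
  · exact gluedForm_of_not_mem G hZ hnot


/-- **Def. 1 for the glued form.**  Suppose: `τM`, `τN` are smooth closed non-degenerate
`2`-forms on the interiors of the pieces; on the seam points with parameter in `(2δ, 3δ)`
(resp. `(-3δ, -2δ)`) the push-forward of `dΛ` agrees with the push-forward of `τM` (resp. `τN`);
and over every seam point with parameter in `(-3δ, 3δ)` the seam primitive `Λ` reads flat as a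
general fold primitive `Φ̂ b̂` (`b̂ ⟂ e₀`) with the fold data at parameter `0` and the symplectic
data elsewhere.  Then the glued form is smooth, closed, and satisfies the transversality and
maximal-rank clauses of Def. 1 along its fold. [cite: Baykur2006, proof of Thm. 6.1] -/
theorem def_one_gluedForm [T2Space M] [T2Space N] [CompactSpace bM.carrier] [CompactSpace bN.carrier]
    (hδ : 0 < δ) (hτMs : IsSmoothForm τM) (hτMc : ∀ a, mextDeriv τM a = 0)
    (hτMn : ∀ (a : InteriorManifold (𝓡∂ 4) M) (v : EuclideanSpace ℝ (Fin 4)), v ≠ 0 →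
      ∃ w : EuclideanSpace ℝ (Fin 4), τM a ![v, w] ≠ 0)
    (hτNs : IsSmoothForm τN) (hτNc : ∀ c, mextDeriv τN c = 0)
    (hτNn : ∀ (c : InteriorManifold (𝓡∂ 4) N) (v : EuclideanSpace ℝ (Fin 4)), v ≠ 0 →
      ∃ w : EuclideanSpace ℝ (Fin 4), τN c ![v, w] ≠ 0)
    (hCM : ∀ p : bM.carrier × ℝ, 2 * δ < p.2 → p.2 < 3 * δ →
      ((mextDeriv Λ).pullback (𝓡 4) (Function.invFun (seamEmb G))) (seamEmb G p) =
        (τM.pullback (𝓡 4) (Function.invFun (intEmbM G))) (seamEmb G p))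
    (hCN : ∀ p : bM.carrier × ℝ, -(3 * δ) < p.2 → p.2 < -(2 * δ) →
      ((mextDeriv Λ).pullback (𝓡 4) (Function.invFun (seamEmb G))) (seamEmb G p) =
        (τN.pullback (𝓡 4) (Function.invFun (intEmbN G))) (seamEmb G p))
    (hflat : ∀ p : bM.carrier × ℝ, -(3 * δ) < p.2 → p.2 < 3 * δ →
      ∃ (Φ : EuclideanSpace ℝ (Fin 4) → ℝ)
        (b : EuclideanSpace ℝ (Fin 4) → EuclideanSpace ℝ (Fin 4) →L[ℝ] ℝ),
        ContDiffOn ℝ ∞ Φ {u | sliceTail u ∈ (extChartAt (𝓡 3) p.1).target} ∧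
        ContDiffOn ℝ ∞ b {u | sliceTail u ∈ (extChartAt (𝓡 3) p.1).target} ∧
        (∀ u, sliceTail u ∈ (extChartAt (𝓡 3) p.1).target → b u (stdVec 0) = 0) ∧
        (∀ u, sliceTail u ∈ (extChartAt (𝓡 3) p.1).target → fderiv ℝ b u (stdVec 0) = 0) ∧
        (∀ u, sliceTail u ∈ (extChartAt (𝓡 3) p.1).target →
          flatRep Λ p.1 u = genFoldPrimitive Φ b u) ∧
        ((fderiv ℝ Φ (seamChart p.1 p) (stdVec 0) = 0 ∧ Φ (seamChart p.1 p) ≠ 0 ∧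
            fderiv ℝ (fun y => fderiv ℝ Φ y (stdVec 0)) (seamChart p.1 p) (stdVec 0) ≠ 0 ∧
            sliceContactVolume (b (seamChart p.1 p)) (fderiv ℝ b (seamChart p.1 p)) ≠ 0) ∨
          pfaffian (genContactFoldForm Φ b (seamChart p.1 p)) ≠ 0)) :
    IsSmoothForm (gluedForm G δ Λ τM τN) ∧ IsClosedForm (gluedForm G δ Λ τM τN) ∧
    (∀ z ∈ fold (gluedForm G δ Λ τM τN),
      fderiv ℝ (fun y => pfaffian ((gluedForm G δ Λ τM τN).inChart z y)) (extChartAt (𝓡 4) z z) ≠ 0) ∧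
    (∀ z ∈ fold (gluedForm G δ Λ τM τN), ∃ v : TangentSpace (𝓡 4) z,
      (∀ w, (gluedForm G δ Λ τM τN) z ![v, w] = 0) ∧
      fderiv ℝ (fun y => pfaffian ((gluedForm G δ Λ τM τN).inChart z y)) (extChartAt (𝓡 4) z z) v ≠ 0) := by
  refine def_one_of_locally fun z => ?_
  rcases mem_seamZone_or G hδ z with ⟨p, hp1, hp2, rfl⟩ | ⟨a, ha, rfl⟩ | ⟨c, hc, rfl⟩
  · obtain ⟨Φ, b, hΦ, hb, hb0, hb1, hrep, hcase⟩ := hflat p hp1 hp2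
    exact def_one_germ_seamEmb G p hΦ hb hb0 hb1 hrep (gluedForm_eventuallyEq_seamEmb G ⟨hp1, hp2⟩) hcase
  · exact def_one_germ_pushforward (injective_intEmbM G) (isOpenMap_intEmbM G) (contMDiff_intEmbM G)
      (contMDiffAt_invFun_intEmbM G) hτMs hτMc hτMn (gluedForm_eventuallyEq_intEmbM G hCM ha)
  · exact def_one_germ_pushforward (injective_intEmbN G) (isOpenMap_intEmbN G) (contMDiff_intEmbN G)
      (contMDiffAt_invFun_intEmbN G) hτNs hτNc hτNn (gluedForm_eventuallyEq_intEmbN G hCN hc)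

end GluedForm

end Literature.Geometry.Symplectic

end
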